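import Mathlib

/-!
# Unipotent display law — KERNEL SHADOW of the cell memo `U-DISPLAY-unipotent1-g5.md`
(MINT block B2 «alphabet UNIPOTENT ∕ homogeneous letters», hsemireg-alphabet-unipotent-1 g5, 2026-08-29)

Crux of record: `Summit.HodgeConjecture.HodgeConjecture.Theses.EightfoldBlochSeeds.BlochSeedDiscOne`
(item stmt-HodgeConjecture-18881; skeleton `Lines/birth.lean` 814a6a70c14e831a, STUB R `stub_rung_pad4_seedAt` —
UNTOUCHED here).  Nothing in this file proves HC, HC_AV, HC_CM, H2, №4/26512 or item 18881, and nothing here is a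
statement about sheaves on `X = S⁴`: it types the finitary ∕ commutative-algebra cores of the pen memo
`hsemireg-alphabet-unipotent-1/g5/memo/U-DISPLAY-unipotent1-g5.md` (director R19.359 ORDER (3): the pen display map for
ONE ⊠-Atiyah block family of the typing U4 on 16·bd78f9c7), so that the two lemmas carrying THEOREM DISP are kernel
facts and not pencil lines.  Mathlib only; no `sorry`; no instances, no notation, no axioms beyond the standard three.

* Part A — LEMMA N (Nakayama–socle law, memo §3), in matrix form over a commutative ring:
  (⇒) `mulVec_not_injective_of_socle`: if an ideal `I` kills a non-zero element `ω` (a socle element: `I·ω = 0`) and a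
  vector `v` with one coordinate regular (`r·v i₀ = 0 → r = 0`) is mapped by `Φ` into `I`-coordinates, then `Φ.mulVec` is
  not injective — the test vector is `ω • v` (the ⊠-version of THEOREM S's socle transport); local-ring corollary
  `mulVec_not_injective_of_maximalIdeal` (`I = 𝔪`, `v i₀ ∉ 𝔪`).
  (⇐) `exists_leftInverse_of_residue_leftInverse`: over a local ring, a left inverse modulo `𝔪` lifts to a left inverse
  (`det (L·Φ) ≡ 1 mod 𝔪` is a unit), and `mulVec_injective_of_leftInverse`.  Mathlib's module-theoretic form of (⇐) is
  `IsLocalRing.split_injective_iff_lTensor_residueField_injective`; the matrix form is what the memo and `udisplay.py` use.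
* Part B — the killed factor value space `K_d = Im ad_N` for `At(c,2)` (SPEC Lemma K; memo §2): for the 2 × 2 Jordan block
  `N`, `ad_N X = N X − X N = [[X₁₀, X₁₁ − X₀₀], [0, −X₁₀]]` (`adN_apply`), so `K_d = {[[γ, e], [0, −γ]]}`; it contains the
  invertible element `ad_N [[0,0],[1,0]] = diag(1, −1)` (`adN_witness`, `adN_witness_det`); the centraliser of `N`
  (the zero-step module maps, the «Toeplitz tie» `ℂ[N]`) is `{X : X₁₀ = 0 ∧ X₀₀ = X₁₁}` (`comm_N_iff`); `N² = 0` and the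
  socle relation `(N₁N₂N₃)·N_k = 0` for pairwise commuting square-zero elements (`socle_mul_rad`).
* Part C — the digits of THEOREM DISP on the design (memo §4) and the Ext bookkeeping (memo §5): copies
  `p = 322 560 ∕ 16 = 20 160`, `q = 6 967 392 ∕ 16 = 435 462` (a₁ → n₁) and `p = 40 320` (a₂ → n₂), case (ii) `q ≥ p + 1`,
  bad-locus codimension `2q − 2p + 1 = 830 605`, the dimension count behind (ii) (`codim_count`), the degree `2p` of
  `det Φ̄ ∈ H⁰(𝒪(2p·t))` and `det Φ = (det Φ̄)⁸ ∈ 𝒪(16p·t)` (`normDegree`), scale-1 non-integrality `16 ∤ 435 462`;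
  the Poincaré-polynomial identities `(4+4X)(2+4X+2X²)³ = 32(1+X)⁷` (U4 pair (a₁,n₁)) and `(1+X)(1+2X+X²)³ = (1+X)⁷`
  (LINE), the coefficients `32·C(7,k) = 32, 224, 672`, and the budget factors `λ ∈ {1, ½, ¼}`.

Labels: [std] = standard commutative algebra; [arith] = digits of record (design bd78f9c7be1aac4e, typing U4
c2464ca55e424b62, logs `g5/data/*` of the cell).  Census-neutral; no instrument run is replaced by this file.
-/

set_option linter.dupNamespace false
set_option autoImplicit false

namespace Summit.HodgeConjecture.HodgeConjecture.Cruxes.BlochSeedDiscOne.UnipotentDisplayLaw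

open Matrix

/-! ## Part A — LEMMA N (Nakayama–socle law) in matrix form -/
section PartA

variable {R : Type*} [CommRing R]

/-- [std] LEMMA N (⇒): a socle test vector.  If `I·ω = 0` with `ω ≠ 0`, and `Φ` maps a vector `v` with a regular
coordinate `v i₀` into `I`-valued coordinates, then `w = ω • v ≠ 0` lies in the kernel of `Φ.mulVec`. -/
theorem mulVec_not_injective_of_socle {m n : Type*} [Fintype m] [Fintype n]
    (I : Ideal R) (ω : R) (hω : ω ≠ 0) (hsoc : ∀ x ∈ I, x * ω = 0)
    (Φ : Matrix n m R) (v : m → R) (i₀ : m) (hv : ∀ r : R, r * v i₀ = 0 → r = 0)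
    (hΦ : ∀ j, (Φ *ᵥ v) j ∈ I) : ¬ Function.Injective (fun w : m → R => Φ *ᵥ w) := by
  intro hinj
  have h1 : Φ *ᵥ (ω • v) = Φ *ᵥ (0 : m → R) := by
    rw [Matrix.mulVec_smul, Matrix.mulVec_zero]
    funext j
    simp only [Pi.smul_apply, smul_eq_mul, Pi.zero_apply]
    rw [mul_comm]
    exact hsoc _ (hΦ j)
  have h2 : ω • v = 0 := hinj h1
  have h3 : ω * v i₀ = 0 := by
    have := congr_fun h2 i₀
    simpa [Pi.smul_apply, smul_eq_mul] using this
  exact hω (hv ω h3)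

/-- [std] LEMMA N (⇒), local-ring form: over a local ring `(R, 𝔪)` with a non-zero `ω` killed by `𝔪` (a socle element —
it exists whenever `R` is Artinian), a vector `v ∉ 𝔪^m` (some coordinate a unit) with `Φ v ∈ 𝔪^n` witnesses that
`Φ.mulVec` is not injective.  Contrapositive = «Φ injective ⇒ Φ̄ = Φ mod 𝔪 injective». -/
theorem mulVec_not_injective_of_maximalIdeal [IsLocalRing R] {m n : Type*} [Fintype m] [Fintype n]
    (ω : R) (hω : ω ≠ 0) (hsoc : ∀ x ∈ IsLocalRing.maximalIdeal R, x * ω = 0)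
    (Φ : Matrix n m R) (v : m → R) (i₀ : m) (hv : v i₀ ∉ IsLocalRing.maximalIdeal R)
    (hΦ : ∀ j, (Φ *ᵥ v) j ∈ IsLocalRing.maximalIdeal R) :
    ¬ Function.Injective (fun w : m → R => Φ *ᵥ w) := by
  have hu : IsUnit (v i₀) := IsLocalRing.notMem_maximalIdeal.mp hv
  exact mulVec_not_injective_of_socle (IsLocalRing.maximalIdeal R) ω hω hsoc Φ v i₀
    (fun r hr => (hu.mul_left_eq_zero).mp hr) hΦ

/-- [std] A left inverse makes `Φ.mulVec` injective (used with (⇐) below: split mono ⇒ injective at the point). -/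
theorem mulVec_injective_of_leftInverse {m n : Type*} [Fintype m] [Fintype n] [DecidableEq m]
    (Φ : Matrix n m R) (L : Matrix m n R) (hL : L * Φ = 1) :
    Function.Injective (fun w : m → R => Φ *ᵥ w) := by
  intro w₁ w₂ h
  have h' : L *ᵥ (Φ *ᵥ w₁) = L *ᵥ (Φ *ᵥ w₂) := by
    simp only at h
    rw [h]
  rw [Matrix.mulVec_mulVec, Matrix.mulVec_mulVec, hL, Matrix.one_mulVec, Matrix.one_mulVec] at h'
  exact h'

/-- [std] LEMMA N (⇐), Nakayama in matrix form: over a local ring, a left inverse of `Φ` modulo `𝔪` lifts to a left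
inverse of `Φ` (because `det (L·Φ) ≡ det 1 = 1 (mod 𝔪)` is a unit).  So «Φ̄ injective (over the residue FIELD, where
injective = has a left inverse) ⇒ Φ is a split monomorphism ⇒ injective with free cokernel». -/
theorem exists_leftInverse_of_residue_leftInverse [IsLocalRing R] {m n : Type*} [Fintype m] [Fintype n]
    [DecidableEq m] (Φ : Matrix n m R) (L : Matrix m n R)
    (hL : ∀ i j, (L * Φ - (1 : Matrix m m R)) i j ∈ IsLocalRing.maximalIdeal R) :
    ∃ L' : Matrix m n R, L' * Φ = 1 := by
  set M : Matrix m m R := L * Φ with hM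
  have hmap : (IsLocalRing.residue R).mapMatrix M = 1 := by
    ext i j
    have hij : IsLocalRing.residue R (M i j - (1 : Matrix m m R) i j) = 0 := by
      have hL' := hL i j
      rw [Matrix.sub_apply] at hL'
      exact (IsLocalRing.residue_eq_zero_iff _).mpr hL'
    rw [map_sub, sub_eq_zero] at hij
    rw [RingHom.mapMatrix_apply, Matrix.map_apply, hij]
    by_cases h : i = j
    · subst h; simp
    · simp [h]
  have hdet : IsUnit M.det := by
    rw [← IsLocalRing.residue_ne_zero_iff_isUnit, RingHom.map_det, hmap, Matrix.det_one]
    exact one_ne_zero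
  refine ⟨M⁻¹ * L, ?_⟩
  rw [Matrix.mul_assoc, ← hM]
  exact Matrix.nonsing_inv_mul M hdet

end PartA

/-! ## Part B — the killed value space `K_d = Im ad_N` and the Toeplitz tie `ℂ[N]` for `At(c,2)` -/
section PartB

variable {R : Type*} [CommRing R]

/-- The 2 × 2 Jordan block (`e₁` = socle, `e₂` = top). -/
def jordanN : Matrix (Fin 2) (Fin 2) R := !![0, 1; 0, 0]

/-- [std] `N² = 0`. -/
theorem jordanN_sq : (jordanN : Matrix (Fin 2) (Fin 2) R) * jordanN = 0 := by
  ext i j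
  simp only [Matrix.mul_apply, Fin.sum_univ_two, jordanN, Matrix.zero_apply]
  fin_cases i <;> fin_cases j <;> simp

/-- [std] SPEC Lemma K for `At(c,2) → At(c,2)` through a killed `c`-step: `ad_N X = N X − X N = [[X₁₀, X₁₁ − X₀₀],[0, −X₁₀]]`,
so `K_d = Im ad_N = {[[γ, e],[0, −γ]]}` (dimension 2, pattern {(0,0),(0,1),(1,1)}, term rank 2). -/
theorem adN_apply (X : Matrix (Fin 2) (Fin 2) R) :
    jordanN * X - X * jordanN = !![X 1 0, X 1 1 - X 0 0; 0, -(X 1 0)] := by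
  ext i j
  simp only [Matrix.sub_apply, Matrix.mul_apply, Fin.sum_univ_two, jordanN]
  fin_cases i <;> fin_cases j <;> simp

/-- [std] Every `[[γ, e],[0, −γ]]` is in `Im ad_N`: it is `ad_N [[0, 0],[γ, e']]` with `e' = e`… precisely
`ad_N [[−e, 0],[γ, 0]] = [[γ, e],[0, −γ]]`. -/
theorem adN_surj (γ e : R) :
    jordanN * !![-e, 0; γ, 0] - !![-e, 0; γ, 0] * jordanN = (!![γ, e; 0, -γ] : Matrix (Fin 2) (Fin 2) R) := by
  rw [adN_apply]
  ext i j
  fin_cases i <;> fin_cases j <;> simp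

/-- [std] `K_d` contains an invertible element: `ad_N [[0,0],[1,0]] = diag(1, −1)`. -/
theorem adN_witness :
    jordanN * !![(0 : R), 0; 1, 0] - !![(0 : R), 0; 1, 0] * jordanN = !![1, 0; 0, -1] := by
  rw [adN_apply]
  ext i j
  fin_cases i <;> fin_cases j <;> simp

/-- [std] … of determinant `−1`. -/
theorem adN_witness_det : Matrix.det (!![1, 0; 0, -1] : Matrix (Fin 2) (Fin 2) R) = -1 := by
  simp [Matrix.det_fin_two]

/-- [std] The Toeplitz tie (SPEC Lemma U, zero step between equal types): `X` commutes with `N` iff `X` is upper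
triangular Toeplitz, `X = x·1 + y·N`. -/
theorem comm_N_iff (X : Matrix (Fin 2) (Fin 2) R) :
    jordanN * X = X * jordanN ↔ (X 1 0 = 0 ∧ X 0 0 = X 1 1) := by
  constructor
  · intro h
    have h' : jordanN * X - X * jordanN = 0 := by rw [h, sub_self]
    rw [adN_apply] at h'
    have h10 : X 1 0 = 0 := by
      have := congr_fun (congr_fun h' 0) 0
      simpa using this
    have h01 : X 1 1 - X 0 0 = 0 := by
      have := congr_fun (congr_fun h' 0) 1
      simpa using this
    exact ⟨h10, (sub_eq_zero.mp h01).symm⟩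
  · rintro ⟨h10, hdiag⟩
    have h' : jordanN * X - X * jordanN = 0 := by
      rw [adN_apply]
      ext i j
      fin_cases i <;> fin_cases j <;> simp [h10, hdiag]
    exact sub_eq_zero.mp h'

/-- [std] The socle relation of `𝒜 = ⊗ₖ ℂ[N_k]∕(N_k²)` (memo §3): for pairwise commuting square-zero elements the product
`ω = N₁N₂N₃` is killed by each `N_k`, hence by the radical `(N₁, N₂, N₃)`. -/
theorem socle_mul_rad {A : Type*} [CommRing A] (N₁ N₂ N₃ : A)
    (h₁ : N₁ * N₁ = 0) (h₂ : N₂ * N₂ = 0) (h₃ : N₃ * N₃ = 0) :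
    N₁ * (N₁ * N₂ * N₃) = 0 ∧ N₂ * (N₁ * N₂ * N₃) = 0 ∧ N₃ * (N₁ * N₂ * N₃) = 0 := by
  refine ⟨?_, ?_, ?_⟩
  · calc N₁ * (N₁ * N₂ * N₃) = (N₁ * N₁) * N₂ * N₃ := by ring
      _ = 0 := by rw [h₁]; ring
  · calc N₂ * (N₁ * N₂ * N₃) = (N₂ * N₂) * N₁ * N₃ := by ring
      _ = 0 := by rw [h₂]; ring
  · calc N₃ * (N₁ * N₂ * N₃) = (N₃ * N₃) * N₁ * N₂ := by ring
      _ = 0 := by rw [h₃]; ring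

/-- [std] … and by every element of the ideal `(N₁, N₂, N₃)` (the hypothesis `hsoc` of Part A for this `𝒜`). -/
theorem socle_mul_span {A : Type*} [CommRing A] (N₁ N₂ N₃ : A)
    (h₁ : N₁ * N₁ = 0) (h₂ : N₂ * N₂ = 0) (h₃ : N₃ * N₃ = 0) :
    ∀ x ∈ Ideal.span ({N₁, N₂, N₃} : Set A), x * (N₁ * N₂ * N₃) = 0 := by
  intro x hx
  obtain ⟨k₁, k₂, k₃⟩ := socle_mul_rad N₁ N₂ N₃ h₁ h₂ h₃
  refine Submodule.span_induction ?_ ?_ ?_ ?_ hx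
  · intro y hy
    simp only [Set.mem_insert_iff, Set.mem_singleton_iff] at hy
    rcases hy with rfl | rfl | rfl
    · exact k₁
    · exact k₂
    · exact k₃
  · simp
  · intro y z _ _ hy hz
    rw [add_mul, hy, hz, add_zero]
  · intro a y _ hy
    rw [smul_eq_mul, mul_assoc, hy, mul_zero]

end PartB

/-! ## Part C — digits of THEOREM DISP (memo §4) and the Ext bookkeeping (memo §5) -/
section PartC

/-- [arith] Copies at scale 16 (⊠-type of rank 16): a₁: `16·20160 ∕ 16 = 20160`, n₁: `16·435462 ∕ 16 = 435462`,
a₂: `16·40320 ∕ 16 = 40320`; per-factor At copies `= m∕2`. -/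
theorem copies_scale16 :
    16 * 20160 / 16 = 20160 ∧ 16 * 435462 / 16 = 435462 ∧ 16 * 40320 / 16 = 40320 ∧
    16 * 20160 = 322560 ∧ 16 * 435462 = 6967392 ∧ 16 * 40320 = 645120 ∧
    322560 / 2 = 161280 ∧ 6967392 / 2 = 3483696 ∧ 645120 / 2 = 322560 := by
  norm_num

/-- [arith] Both families are in case (ii) `q ≥ p + 1` of THEOREM DISP: `q − p = 415 302` resp. `395 142`, and the
non-injective locus in `Mat_{2q×2p}` has codimension `2q − 2p + 1 = 830 605` resp. `790 285`. -/
theorem caseII_digits :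
    435462 ≥ 20160 + 1 ∧ 435462 - 20160 = 415302 ∧ 2 * 435462 - 2 * 20160 + 1 = 830605 ∧
    435462 ≥ 40320 + 1 ∧ 435462 - 40320 = 395142 ∧ 2 * 435462 - 2 * 40320 + 1 = 790285 := by
  norm_num

/-- [std] The dimension count of THEOREM DISP (ii): the incidence variety over `E ∖ t` has dimension
`D + 1 − (2q − 2p + 1)` (`D = 4pq` parameters, `+1` for the curve), which is `< D` iff `q ≥ p + 1` (for `q ≥ p`). -/
theorem codim_count (p q D : ℕ) (hpq : p ≤ q) :
    D + 1 < D + (2 * q - 2 * p + 1) ↔ p + 1 ≤ q := by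
  omega

/-- [arith] Case (iii) `q = p`: `det Φ̄ ∈ H⁰(E, 𝒪(2p·t))` has positive degree for `p ≥ 1`, so it vanishes on `2p` points;
over `ℂ`, `det Φ = (det Φ̄)^8` (`dim 𝒜 = 2³ = 8`) lives in `𝒪(16p·t) = det 𝓤_n^{p} ⊗ (det 𝓤_a^{p})⁻¹|_E`. -/
theorem normDegree (p : ℕ) (hp : 1 ≤ p) : 0 < 2 * p ∧ 2 ^ 3 = 8 ∧ 8 * (2 * p) = 16 * p := by
  refine ⟨by omega, by norm_num, by omega⟩

/-- [arith] Scale-1 parity (front page): `435 462 ∕ 16` is not an integer (`435 462 = 16·27216 + 6`), while the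
sources would be integral (`20160 = 16·1260`, `40320 = 16·2520`). -/
theorem scale1_parity : 435462 % 16 = 6 ∧ 20160 % 16 = 0 ∧ 40320 % 16 = 0 := by
  norm_num

/-- [arith] Neighbourhood digits (`corner-l-1-bd78f9c7-U4.txt`): a₁'s four other exits carry N-mass `1+1+2+8 = 12 < 20160`
(single-exit in the min-cut sense); n₁'s 151 feeders carry `30 907 731 = 71·435 462 − 10 071` (`> 70·m(n₁)`). -/
theorem corner_digits :
    1 + 1 + 2 + 8 = 12 ∧ 12 < 20160 ∧ 70 * 435462 < 30907731 ∧ 30907731 < 71 * 435462 := by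
  norm_num

open Polynomial in
/-- [std] Künneth as Poincaré polynomials (memo §5): the U4 pair (a₁, n₁) has factor polynomials `4 + 4X` (live l₋₁ step,
colour = class) and `(2 + 4X + 2X²)` three times (same-colour zero At steps); their product is `32(1+X)⁷`. -/
theorem poincare_U4_pair :
    ((4 : ℤ[X]) + 4 * X) * (2 + 4 * X + 2 * X ^ 2) ^ 3 = 32 * (1 + X) ^ 7 := by
  ring

open Polynomial in
/-- [std] … and LINE's (𝒪 everywhere): `(1 + X)(1 + 2X + X²)³ = (1 + X)⁷`. -/
theorem poincare_LINE_pair :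
    ((1 : ℤ[X]) + X) * (1 + 2 * X + X ^ 2) ^ 3 = (1 + X) ^ 7 := by
  ring

/-- [arith] Hence per copy pair `hom = 32`, `ext¹ = 32·7 = 224`, `ext² = 32·21 = 672` (U4) against `1, 7, 21` (LINE), and
per unit of LINE mass (divide by `16·16 = 256`) every degree scales by `32∕256 = 1∕8 = 1·½·½·½`. -/
theorem ext_digits :
    Nat.choose 7 1 = 7 ∧ Nat.choose 7 2 = 21 ∧ 32 * 7 = 224 ∧ 32 * 21 = 672 ∧ 16 * 16 = 256 ∧
    (32 : ℚ) / 256 = 1 / 8 ∧ (1 : ℚ) * (1 / 2) * (1 / 2) * (1 / 2) = 1 / 8 := by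
  refine ⟨by decide, by decide, by norm_num, by norm_num, by norm_num, by norm_num, by norm_num⟩

/-- [arith] BUDGET LAW factors (memo §5): per factor and per unit of LINE mass, with U4 per-factor copies `m∕2` for At:
zero step At_c→At_c `(2,4,2)∕4 = ½·(1,2,1)`, At_c→At_c′ `(1,2,1)∕4 = ¼·(1,2,1)`, 𝒪↔At `(1,2,1)∕2 = ½·(1,2,1)`;
null c′: At_c′→At_c′ `(4,4,0)∕4 = 1·(1,1,0)`, other At pairs `(2,2,0)∕4 = ½·(1,1,0)`, 𝒪↔At_c′ `(2,2,0)∕2 = (1,1,0)`,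
𝒪↔At_c `(1,1,0)∕2 = ½·(1,1,0)` — all `≤ 1`: a ⊠-Atiyah typing never raises an Ext budget. -/
theorem budget_factors :
    (2 : ℚ) / 4 = 1 / 2 ∧ (4 : ℚ) / 4 = 2 * (1 / 2) ∧ (1 : ℚ) / 4 ≤ 1 ∧ (1 : ℚ) / 2 ≤ 1 ∧
    (4 : ℚ) / 4 = 1 ∧ (2 : ℚ) / 2 = 1 ∧ (1 : ℚ) / 2 = 1 / 2 := by
  norm_num

end PartC

end Summit.HodgeConjecture.HodgeConjecture.Cruxes.BlochSeedDiscOne.UnipotentDisplayLaw
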